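import Mathlib
import HarnessLib
import Literature.MathematicalPhysics.QuantumFieldTheory.ConstructiveQFTWave0
import Summits.Ventures.LatticeQCDFlow.Exactness.LatticeCoordAvg
import Summits.Ventures.LatticeQCDFlow.Scaling.AutoregressiveGaugeRedundancy
import Summits.Ventures.LatticeQCDFlow.Scaling.GaugeForestTrivial

/-!
# LatticeQCDFlow / Scaling — gauge redundancy of the autoregressive context, VI: forests are gauge
# trivial, so the marginal of the links of ANY forest is constant for EVERY gauge-invariant weight

HONEST FRAMING: exact (Metropolis-corrected) sampling algorithms for lattice gauge theory;
figures of merit are autocorrelation/cost numbers at stated couplings and volumes; no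
continuum-physics claim.

Venture `LatticeQCDFlow` (cell pub-lqcd), topic `Scaling`, FANOUT row 30 (lean-1, GEN-15) — OUR WORK,
a measurability-free strengthening of file IV (`Scaling/AutoregressiveGaugeRedundancyForest`: the
links of a forest are jointly Haar for gauge-invariant BOUNDED MEASURABLE weights, by burial + a
Fubini tower step).  Here the same conclusion — the partial Haar marginal `A_{Tᶜ} F`
(`Exactness.coordAvg`) of the links of a forest `T` is CONSTANT — for EVERY gauge-invariant `F`
(no measurability, no integrability, every group with Haar probability), from a purely combinatorial
fact and file I's master identity `coordAvg_eq_of_gaugeRelated_off`: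

* the combinatorial input is `Scaling/GaugeForestTrivial` (**`exists_gaugeTransform_eq_on_forest`**
  — FORESTS ARE GAUGE TRIVIAL: for a pruning certificate `T = [(ℓ_1,x_1), …, (ℓ_k,x_k)]` and ANY two
  configurations there is a gauge transformation mapping one to the other on every link of `T`);
* the rank form and THE COMB (`≥ L^d − 1` links): `coordAvg_rankForest_const`,
  **`coordAvg_comb_subset_const`** (every subset of the comb has constant marginal),
  **`arConditional_comb_const`** (generating the comb first in ANY order, every one of its
  `≥ L^d − 1` exact conditionals is constant: Haar, context empty);
* **`coordAvg_forest_const'`** — hence `A_{(ℓ_1…ℓ_k)ᶜ} F (U) = A_{(ℓ_1…ℓ_k)ᶜ} F (U')` for all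
  `U, U'` and every gauge-invariant `F`; **`arConditional_forest_const`** — generating the links of a
  forest first, every exact autoregressive conditional `A_s F / A_{insert a s} F` is constant in
  everything generated so far and in the new link: Haar, context EMPTY (file IV adds the value `1`
  of the ratio when `F` is bounded measurable with `∫F ≠ 0`).

READING (value-free, for THEORY-2 §4 C5 / T2-AF): maximal-tree gauge fixing in marginal /
autoregressive form with no analytic hypothesis at all: up to `L^d − 1` consecutive exact
autoregressive conditionals of ANY lattice gauge theory in link variables are information-free.
NOT CLAIMED: the converse (a cycle-closing link does read the cycle's holonomy class — file V,
`AutoregressiveGaugePlaquetteClass`, for plaquettes); any number of ours.  Elementary over file I;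
no definition is introduced; nothing is cited as a fact; no `sorry`.
-/

noncomputable section

namespace Summit.Ventures.LatticeQCDFlow.Theory2.Autoregressive

open MeasureTheory Function
open Literature.MathematicalPhysics.QuantumFieldTheory
open Summit.Ventures.LatticeQCDFlow.Exactness

variable {d L N : ℕ} {G : Type*} [Group G]

/-! ## The marginal of a forest is constant, for every gauge-invariant weight -/

variable [TopologicalSpace G] [IsTopologicalGroup G] [CompactSpace G] [MeasurableSpace G]
  [BorelSpace G]

/-- **THE MARGINAL OF THE LINKS OF A FOREST IS CONSTANT** — every group with Haar probability, every
gauge-invariant `F`, no measurability needed: for a pruning certificate `T`,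
`A_{(ℓ_1…ℓ_k)ᶜ} F (U) = A_{(ℓ_1…ℓ_k)ᶜ} F (U')` for all `U, U'` (forests are gauge trivial + file I's
master identity `coordAvg_eq_of_gaugeRelated_off`). [ours] -/
theorem coordAvg_forest_const' [NeZero L] {F : GaugeConfig d L G → ℝ} (hF : IsGaugeInvariant F)
    (T : List (Edge d L × Site d L))
    (hinc : ∀ p ∈ T, (p.1.1 = p.2 ∨ p.1.1.shift p.1.2 = p.2) ∧ p.1.1 ≠ p.1.1.shift p.1.2)
    (hpw : T.Pairwise (fun p q => ¬ (q.1.1 = p.2 ∨ q.1.1.shift q.1.2 = p.2)))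
    (U U' : GaugeConfig d L G) :
    coordAvg (haarProbability G) (Finset.univ \ (T.map Prod.fst).toFinset) F U' =
      coordAvg (haarProbability G) (Finset.univ \ (T.map Prod.fst).toFinset) F U := by
  obtain ⟨γ, hγ⟩ := exists_gaugeTransform_eq_on_forest T hinc hpw U U'
  refine coordAvg_eq_of_gaugeRelated_off _ hF γ fun e he => ?_
  have he' : e ∈ (T.map Prod.fst).toFinset := by
    by_contra h
    exact he (Finset.mem_sdiff.2 ⟨Finset.mem_univ _, h⟩)
  rw [List.mem_toFinset, List.mem_map] at he'
  obtain ⟨p, hp, rfl⟩ := he'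
  exact (hγ p hp).symm

/-- **EXACT AUTOREGRESSIVE CONDITIONALS ALONG A FOREST ARE CONSTANT** (Haar, empty context), for
every gauge-invariant weight: if `(a, y) :: T` is a pruning certificate (the forest `T ∪ {a}`), then
the conditional density `A_s F / A_{insert a s} F` of the next link `a` given the generated forest
links `T` (`s = (insert a T)ᶜ`) takes the same value on any two configurations. [ours] -/
theorem arConditional_forest_const [NeZero L] {F : GaugeConfig d L G → ℝ} (hF : IsGaugeInvariant F)
    (a : Edge d L) (y : Site d L) (T : List (Edge d L × Site d L))
    (hinc : ∀ p ∈ (a, y) :: T, (p.1.1 = p.2 ∨ p.1.1.shift p.1.2 = p.2) ∧ p.1.1 ≠ p.1.1.shift p.1.2)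
    (hpw : ((a, y) :: T).Pairwise (fun p q => ¬ (q.1.1 = p.2 ∨ q.1.1.shift q.1.2 = p.2)))
    (U U' : GaugeConfig d L G) :
    coordAvg (haarProbability G) (Finset.univ \ (((a, y) :: T).map Prod.fst).toFinset) F U' /
        coordAvg (haarProbability G)
          (insert a (Finset.univ \ (((a, y) :: T).map Prod.fst).toFinset)) F U' =
      coordAvg (haarProbability G) (Finset.univ \ (((a, y) :: T).map Prod.fst).toFinset) F U /
        coordAvg (haarProbability G)
          (insert a (Finset.univ \ (((a, y) :: T).map Prod.fst).toFinset)) F U := by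
  obtain ⟨hp, hpw'⟩ := List.pairwise_cons.1 hpw
  have hinc' : ∀ q ∈ T, (q.1.1 = q.2 ∨ q.1.1.shift q.1.2 = q.2) ∧ q.1.1 ≠ q.1.1.shift q.1.2 :=
    fun q hq => hinc q (List.mem_cons_of_mem _ hq)
  have hainc := (hinc (a, y) List.mem_cons_self).1
  have hnot : a ∉ (T.map Prod.fst).toFinset := by
    intro hmem
    rw [List.mem_toFinset, List.mem_map] at hmem
    obtain ⟨q, hq, hq1⟩ := hmem
    exact hp q hq (by rw [hq1]; exact hainc)
  have hs' : insert a (Finset.univ \ (((a, y) :: T).map Prod.fst).toFinset) =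
      Finset.univ \ (T.map Prod.fst).toFinset := by
    ext e
    simp only [List.map_cons, List.toFinset_cons, Finset.mem_insert, Finset.mem_sdiff,
      Finset.mem_univ, true_and, not_or]
    constructor
    · rintro (rfl | ⟨_, h2⟩)
      · exact hnot
      · exact h2
    · intro he
      by_cases hea : e = a
      · exact Or.inl hea
      · exact Or.inr ⟨hea, he⟩
  rw [hs', coordAvg_forest_const' hF ((a, y) :: T) hinc hpw U U',
    coordAvg_forest_const' hF T hinc' hpw' U U']

/-! ## The rank form and the comb: `≥ L^d − 1` links, every generation order -/

/-- **Rank-form forests have constant marginal**, for every gauge-invariant `F` (rank certificate of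
`Scaling/GaugeForestTrivial`: private endpoints `x`, rank `r`, no other link of rank `≤ r ℓ` touches
`x ℓ`). [ours] -/
theorem coordAvg_rankForest_const [NeZero L] {F : GaugeConfig d L G → ℝ} (hF : IsGaugeInvariant F)
    (x : Edge d L → Site d L) (r : Edge d L → ℕ) (T : Finset (Edge d L))
    (hinc : ∀ ℓ ∈ T, (ℓ.1 = x ℓ ∨ ℓ.1.shift ℓ.2 = x ℓ) ∧ ℓ.1 ≠ ℓ.1.shift ℓ.2)
    (hfree : ∀ ℓ ∈ T, ∀ ℓ' ∈ T, ℓ' ≠ ℓ → r ℓ' ≤ r ℓ → ¬ (ℓ'.1 = x ℓ ∨ ℓ'.1.shift ℓ'.2 = x ℓ))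
    (U U' : GaugeConfig d L G) :
    coordAvg (haarProbability G) (Finset.univ \ T) F U' =
      coordAvg (haarProbability G) (Finset.univ \ T) F U := by
  classical
  obtain ⟨γ, hγ⟩ := exists_gaugeTransform_eq_on_rankForest x r T hinc hfree U U'
  refine coordAvg_eq_of_gaugeRelated_off _ hF γ fun e he => ?_
  have he' : e ∈ T := by
    by_contra h
    exact he (Finset.mem_sdiff.2 ⟨Finset.mem_univ _, h⟩)
  exact (hγ e he').symm

/-- **EVERY SUBSET OF THE COMB HAS CONSTANT MARGINAL** — every compact `G`, every gauge-invariant `F`: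
for `T ⊆ treeEdges d L` (the comb, `≥ L^d − 1` links, `GaugeForestTrivial.card_comb_ge`) the
marginal `A_{Tᶜ} F` of the links of `T` takes the same value on all configurations. [ours] -/
theorem coordAvg_comb_subset_const [NeZero L] {F : GaugeConfig d L G → ℝ} (hF : IsGaugeInvariant F)
    {T : Finset (Edge d L)} (hT : T ⊆ Lattice.treeEdges d L) (U U' : GaugeConfig d L G) :
    coordAvg (haarProbability G) (Finset.univ \ T) F U' =
      coordAvg (haarProbability G) (Finset.univ \ T) F U := by
  classical
  obtain ⟨γ, hγ⟩ := exists_gaugeTransform_eq_on_comb_subset hT U U'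
  refine coordAvg_eq_of_gaugeRelated_off _ hF γ fun e he => ?_
  have he' : e ∈ T := by
    by_contra h
    exact he (Finset.mem_sdiff.2 ⟨Finset.mem_univ _, h⟩)
  exact (hγ e he').symm

/-- **`≥ L^d − 1` INFORMATION-FREE STEPS IN EVERY ORDER.**  Generate the links of the comb
(`treeEdges d L`) first, in ANY order: if `T ⊆ treeEdges` has been generated and `a ∈ treeEdges ∖ T`
is next (`s = (insert a T)ᶜ` still to come), the exact conditional density `A_s F / A_{insert a s} F`
of `U_a` takes the same value on any two configurations — Haar, context EMPTY — for every
gauge-invariant weight `F` and every compact `G`. [ours] -/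
theorem arConditional_comb_const [NeZero L] {F : GaugeConfig d L G → ℝ} (hF : IsGaugeInvariant F)
    {T : Finset (Edge d L)} {a : Edge d L} (hT : T ⊆ Lattice.treeEdges d L)
    (ha : a ∈ Lattice.treeEdges d L) (haT : a ∉ T) (U U' : GaugeConfig d L G) :
    coordAvg (haarProbability G) (Finset.univ \ insert a T) F U' /
        coordAvg (haarProbability G) (insert a (Finset.univ \ insert a T)) F U' =
      coordAvg (haarProbability G) (Finset.univ \ insert a T) F U /
        coordAvg (haarProbability G) (insert a (Finset.univ \ insert a T)) F U := by
  classical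
  have hins : insert a (Finset.univ \ insert a T) = Finset.univ \ T := by
    ext e
    simp only [Finset.mem_insert, Finset.mem_sdiff, Finset.mem_univ, true_and, not_or]
    constructor
    · rintro (rfl | ⟨_, h2⟩)
      · exact haT
      · exact h2
    · intro he
      by_cases hea : e = a
      · exact Or.inl hea
      · exact Or.inr ⟨hea, he⟩
  have hT' : insert a T ⊆ Lattice.treeEdges d L := Finset.insert_subset ha hT
  rw [hins, coordAvg_comb_subset_const hF hT' U U', coordAvg_comb_subset_const hF hT U U']

end Summit.Ventures.LatticeQCDFlow.Theory2.Autoregressive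

end
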